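import Summits.QuantumFields.BalabanUV.T4Continuum.Support.NE7K1LinTorusLineSymbol

/-!
# NE7K1LinTorusSymbolReal — row NE7 (node U5), candidate route HOM, path H1L, cell K1-lin(s): B-E1's REAL-TORUS CLAUSE (a′) —
# the symbol `σ_s(p)` of the doubled-torus two-cutoff line is REAL, EVEN, base-point free, and ORDERED BY THE LÖWNER ORDER
# (NEEDS-ESTIMATE #E1, B-E1 — the symbol-side dictionary «form inequality ⇒ symbol inequality»)

Lineage `b2b-balaban-t4-ne7-p2` (CRUX PROVER NE7 #2), generation 73; file 38.  Files 36–37 (`NE7K1LinTorusLineInvariant`,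
`NE7K1LinTorusLineSymbol`) typed B-E1's OBJECT: at `a = 0` the doubled-torus line `T^𝕋(s)` is a convolution and every plane wave
`χ_p` is an eigenvector with eigenvalue `σ_s(p) = torSymb … s y₀ p`.  PRICING-NE7 v29 §216 (N-30-1) ∕ lens 2 g58 `I2I3-SUPPLY.md`
§4 list the class-S CLAUSES the strip engine consumes of a symbol: (a′) evenness ∕ reality, (c′) a two-sided window on the real
torus, (b′)(e′) analyticity and bounds in a strip.  THIS FILE is the [folklore] dictionary for the REAL-TORUS clauses:

* §1 the characters have unit modulus (`norm_chiT`, `chiT_mul_conj`) and `conj χ_p = χ_{−p}` (`conj_chiT`).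
* §2 **`sum_conj_mul_apply_mul`**: for a REAL SYMMETRIC matrix `X` and a complex vector `z = u + iv`,
  `Σ_x Σ_y conj(z_x)·X(x,y)·z_y = ⟨u, Xu⟩ + ⟨v, Xv⟩` — the cross terms cancel by symmetry.
* §3 **`symbT_eq_forms`**: for a real symmetric TRANSLATION-INVARIANT matrix on the representatives `boxDom P`,
  `symbT X y₀ p = (⟨c_p, Xc_p⟩ + ⟨s_p, Xs_p⟩) ∕ |boxDom P|` with `c_p = Re χ_p`, `s_p = Im χ_p` — hence the symbol is REAL
  (`symbT_im_eq_zero`), independent of the base point (`symbT_indep`), EVEN in `p` (`symbT_neg`), NON-NEGATIVE for `X ⪰ 0`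
  (`symbT_re_nonneg`) and MONOTONE: `X ⪯ Y ⇒ symb X ≤ symb Y` (`symbT_re_mono`) — the port through which every quadratic-form
  comparison of the torus line becomes a clause on `σ_s`; and the row is even: `X(y₀, y₀+v) = X(y₀, y₀−v)` (`apply_wrap_add_eq`).
* §4 THE TORUS LINE: `torB`, its hard Schur complement and `torLine(s)` are symmetric (`torB_isSymm`, `schurC_torB_isSymm`,
  `torLine_isSymm`, `torLineRep_isSymm`), so at `a = 0`: **`torSymb_im_eq_zero`** (σ_s(p) ∈ ℝ), **`torSymb_eq_forms`**,
  `torSymb_indep`, **`torSymb_neg`** (σ_s(−p) = σ_s(p)), **`torLineRep_row_even`** (`T^𝕋(s)(y₀, y₀+v) = T^𝕋(s)(y₀, y₀−v)`).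

HONEST FRAMING: [folklore] (finite Fourier analysis ∕ linear algebra on a discrete torus); no estimate; `a = 0`; the WINDOW (c′) is
files 39–40, the STRIP clauses (b′)(e′) are NOT typed (they need I3 on the torus); nothing of Bałaban's asserted; no `sorry`.
Census only (B-E1's clause (a′) on the finite doubled torus, every size); NE7 NOT PRINTED ∕ NOT PROVED; spine 0∕9; FIXED FINITE
T⁴, rung (B)+1; NOT infinite volume, NOT mass gap, NOT Clay.  HONEST DEPENDENCY: continuum YM on T⁴ ⇐ BetaPertH ∧ nine spine
estimates (0/9 proved); BetaPertH ⇐ (D1) ∧ (D4) ∧ CAP+tail; G-an2-4 gates asym, D1 and NE2/3/4.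
-/

noncomputable section

open Finset Matrix Complex

namespace Summit.QuantumFields.BalabanUV.T4Continuum.NE7K1LinTorusSymbolReal

open Literature.MathematicalPhysics.QuantumFieldTheory.Balaban1983to89
open Literature.MathematicalPhysics.QuantumFieldTheory.Balaban1983to89.B4Reflection242
open Literature.MathematicalPhysics.QuantumFieldTheory.Balaban1983to89.B4Lower18
open Literature.MathematicalPhysics.QuantumFieldTheory.Balaban1983to89.B4TorusPositivity (wrap wrap_wrap_add)
open NE7K1LinFoldKernels NE7K1LinFoldMatrices NE7K1LinSchurFold NE7K1LinTorusChart NE7K1LinSchurFoldBox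
  NE7K1LinTorusLineInvariant NE7K1LinTorusLineSymbol NE7K1LinSchurLineU1 NE7K1LinSchurLineForm

variable {d : ℕ}

/-! ### §1 Characters: unit modulus and conjugation -/

/-- the character as `exp(θ·I)` with a REAL phase `θ = 2π·Σ_μ p_μy_μ∕P_μ`. [folklore] -/
theorem chiT_eq_exp_ofReal (P : Fin (d + 1) → ℕ) (p y : Fin (d + 1) → ℤ) :
    chiT P p y = Complex.exp (((2 * Real.pi * ∑ μ, ((p μ * y μ : ℤ) : ℝ) / (P μ : ℝ) : ℝ) : ℂ) * Complex.I) := by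
  unfold chiT
  congr 1
  push_cast
  ring

/-- `‖χ_p(y)‖ = 1`. [folklore] -/
theorem norm_chiT (P : Fin (d + 1) → ℕ) (p y : Fin (d + 1) → ℤ) : ‖chiT P p y‖ = 1 := by
  rw [chiT_eq_exp_ofReal, Complex.norm_exp_ofReal_mul_I]

/-- `χ_p(y)·conj χ_p(y) = 1`. [folklore] -/
theorem chiT_mul_conj (P : Fin (d + 1) → ℕ) (p y : Fin (d + 1) → ℤ) :
    chiT P p y * starRingEnd ℂ (chiT P p y) = 1 := by
  rw [Complex.mul_conj, Complex.normSq_eq_norm_sq, norm_chiT]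
  simp

/-- `conj χ_p = χ_{−p}`. [folklore] -/
theorem conj_chiT (P : Fin (d + 1) → ℕ) (p y : Fin (d + 1) → ℤ) : starRingEnd ℂ (chiT P p y) = chiT P (-p) y := by
  rw [chiT_eq_exp_ofReal, chiT_eq_exp_ofReal, ← Complex.exp_conj, map_mul, Complex.conj_ofReal, Complex.conj_I]
  congr 1
  have e : (∑ μ, (((-p) μ * y μ : ℤ) : ℝ) / (P μ : ℝ)) = -∑ μ, ((p μ * y μ : ℤ) : ℝ) / (P μ : ℝ) := by
    rw [← Finset.sum_neg_distrib]
    refine Finset.sum_congr rfl fun μ _ => ?_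
    simp only [Pi.neg_apply]
    push_cast
    ring
  rw [e]
  push_cast
  ring

/-! ### §2 Complex quadratic forms of REAL SYMMETRIC matrices -/

section Forms

variable {ι : Type*} [Fintype ι]

/-- one summand: real and imaginary parts of `conj(z_x)·X·z_y`. [folklore] -/
theorem conj_mul_mul_re_im (r : ℝ) (a b : ℂ) :
    (starRingEnd ℂ a * (r : ℂ) * b).re = r * (a.re * b.re + a.im * b.im) ∧
      (starRingEnd ℂ a * (r : ℂ) * b).im = r * (a.re * b.im - a.im * b.re) := by
  constructor
  · simp only [Complex.mul_re, Complex.mul_im, Complex.conj_re, Complex.conj_im, Complex.ofReal_re, Complex.ofReal_im]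
    ring
  · simp only [Complex.mul_re, Complex.mul_im, Complex.conj_re, Complex.conj_im, Complex.ofReal_re, Complex.ofReal_im]
    ring

/-- **`Σ_x Σ_y conj(z_x)·X(x,y)·z_y = ⟨Re z, X Re z⟩ + ⟨Im z, X Im z⟩` for a REAL SYMMETRIC `X`** — the cross terms cancel by
symmetry. [folklore] -/
theorem sum_conj_mul_apply_mul (X : Matrix ι ι ℝ) (hX : X.IsSymm) (z : ι → ℂ) :
    ∑ x, ∑ y, starRingEnd ℂ (z x) * (X x y : ℂ) * z y =
      (((fun x => (z x).re) ⬝ᵥ X *ᵥ (fun x => (z x).re) +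
        (fun x => (z x).im) ⬝ᵥ X *ᵥ (fun x => (z x).im) : ℝ) : ℂ) := by
  apply Complex.ext
  · rw [Complex.re_sum, Complex.ofReal_re]
    simp_rw [Complex.re_sum, (conj_mul_mul_re_im _ _ _).1]
    simp only [dotProduct, mulVec, Finset.mul_sum, ← Finset.sum_add_distrib]
    refine Finset.sum_congr rfl fun x _ => Finset.sum_congr rfl fun y _ => ?_
    ring
  · rw [Complex.im_sum, Complex.ofReal_im]
    simp_rw [Complex.im_sum, (conj_mul_mul_re_im _ _ _).2]
    have hsw : ∑ x, ∑ y, X x y * ((z x).im * (z y).re) = ∑ x, ∑ y, X x y * ((z x).re * (z y).im) := by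
      rw [Finset.sum_comm]
      refine Finset.sum_congr rfl fun x _ => Finset.sum_congr rfl fun y _ => ?_
      rw [hX.apply y x]
      ring
    simp only [mul_sub, Finset.sum_sub_distrib, hsw, sub_self]

end Forms

/-! ### §3 Symbols of real symmetric translation-invariant matrices: real, base-point free, even, Löwner-monotone -/

section Symbol

variable {P : Fin (d + 1) → ℕ}

/-- the representatives are non-empty. [folklore] -/
theorem card_boxDom_pos (hP : ∀ i, 1 ≤ P i) : 0 < Fintype.card ↥(boxDom P) :=
  Fintype.card_pos_iff.2 ⟨⟨wrap P 0, wrap_mem_boxDom hP 0⟩⟩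

/-- `Σ_x conj χ_p(x)·(Σ_y X(x,y)χ_p(y)) = |boxDom P|·symbT X y₀ p` for a translation-invariant `X`. [folklore] -/
theorem sum_conj_chiT_mul_sum (hP : ∀ i, 1 ≤ P i) (X : Matrix ↥(boxDom P) ↥(boxDom P) ℝ)
    (hX : ∀ (v : Fin (d + 1) → ℤ) (x y : ↥(boxDom P)),
      X ⟨wrap P (x.1 + v), wrap_mem_boxDom hP _⟩ ⟨wrap P (y.1 + v), wrap_mem_boxDom hP _⟩ = X x y)
    (y₀ : ↥(boxDom P)) (p : Fin (d + 1) → ℤ) :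
    ∑ x : ↥(boxDom P), starRingEnd ℂ (chiT P p x.1) * ∑ y : ↥(boxDom P), (X x y : ℂ) * chiT P p y.1 =
      (Fintype.card ↥(boxDom P) : ℂ) * symbT P X y₀ p := by
  have h : ∀ x : ↥(boxDom P), starRingEnd ℂ (chiT P p x.1) * ∑ y : ↥(boxDom P), (X x y : ℂ) * chiT P p y.1 =
      symbT P X y₀ p := by
    intro x
    rw [sum_mul_chiT_of_transl hP X hX y₀ x p, mul_comm, mul_assoc, chiT_mul_conj, mul_one]
  simp_rw [h]
  rw [Finset.sum_const, Finset.card_univ, nsmul_eq_mul]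

/-- **THE SYMBOL AS TWO REAL QUADRATIC FORMS**: for a real symmetric translation-invariant `X` on `boxDom P`,
`symbT X y₀ p = (⟨c_p, Xc_p⟩ + ⟨s_p, Xs_p⟩)∕|boxDom P|` with `c_p = Re χ_p`, `s_p = Im χ_p`. [folklore] -/
theorem symbT_eq_forms (hP : ∀ i, 1 ≤ P i) (X : Matrix ↥(boxDom P) ↥(boxDom P) ℝ) (hXs : X.IsSymm)
    (hX : ∀ (v : Fin (d + 1) → ℤ) (x y : ↥(boxDom P)),
      X ⟨wrap P (x.1 + v), wrap_mem_boxDom hP _⟩ ⟨wrap P (y.1 + v), wrap_mem_boxDom hP _⟩ = X x y)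
    (y₀ : ↥(boxDom P)) (p : Fin (d + 1) → ℤ) :
    symbT P X y₀ p =
      ((((fun x : ↥(boxDom P) => (chiT P p x.1).re) ⬝ᵥ X *ᵥ (fun x => (chiT P p x.1).re) +
          (fun x : ↥(boxDom P) => (chiT P p x.1).im) ⬝ᵥ X *ᵥ (fun x => (chiT P p x.1).im)) /
        (Fintype.card ↥(boxDom P) : ℝ) : ℝ) : ℂ) := by
  have hc : (Fintype.card ↥(boxDom P) : ℂ) ≠ 0 := by exact_mod_cast (card_boxDom_pos hP).ne'
  have h1 := sum_conj_chiT_mul_sum hP X hX y₀ p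
  have h2 : ∑ x : ↥(boxDom P), starRingEnd ℂ (chiT P p x.1) * ∑ y : ↥(boxDom P), (X x y : ℂ) * chiT P p y.1 =
      ∑ x : ↥(boxDom P), ∑ y : ↥(boxDom P), starRingEnd ℂ (chiT P p x.1) * (X x y : ℂ) * chiT P p y.1 := by
    refine Finset.sum_congr rfl fun x _ => ?_
    rw [Finset.mul_sum]
    exact Finset.sum_congr rfl fun y _ => by ring
  rw [h2, sum_conj_mul_apply_mul X hXs] at h1
  rw [Complex.ofReal_div, Complex.ofReal_natCast, eq_div_iff hc, mul_comm, ← h1]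

/-- **THE SYMBOL IS REAL** (clause (a′), reality). [folklore] -/
theorem symbT_im_eq_zero (hP : ∀ i, 1 ≤ P i) (X : Matrix ↥(boxDom P) ↥(boxDom P) ℝ) (hXs : X.IsSymm)
    (hX : ∀ (v : Fin (d + 1) → ℤ) (x y : ↥(boxDom P)),
      X ⟨wrap P (x.1 + v), wrap_mem_boxDom hP _⟩ ⟨wrap P (y.1 + v), wrap_mem_boxDom hP _⟩ = X x y)
    (y₀ : ↥(boxDom P)) (p : Fin (d + 1) → ℤ) : (symbT P X y₀ p).im = 0 := by
  rw [symbT_eq_forms hP X hXs hX y₀ p, Complex.ofReal_im]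

/-- the real part of the symbol, as forms. [folklore] -/
theorem symbT_re_eq (hP : ∀ i, 1 ≤ P i) (X : Matrix ↥(boxDom P) ↥(boxDom P) ℝ) (hXs : X.IsSymm)
    (hX : ∀ (v : Fin (d + 1) → ℤ) (x y : ↥(boxDom P)),
      X ⟨wrap P (x.1 + v), wrap_mem_boxDom hP _⟩ ⟨wrap P (y.1 + v), wrap_mem_boxDom hP _⟩ = X x y)
    (y₀ : ↥(boxDom P)) (p : Fin (d + 1) → ℤ) :
    (symbT P X y₀ p).re =
      ((fun x : ↥(boxDom P) => (chiT P p x.1).re) ⬝ᵥ X *ᵥ (fun x => (chiT P p x.1).re) +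
          (fun x : ↥(boxDom P) => (chiT P p x.1).im) ⬝ᵥ X *ᵥ (fun x => (chiT P p x.1).im)) /
        (Fintype.card ↥(boxDom P) : ℝ) := by
  rw [symbT_eq_forms hP X hXs hX y₀ p, Complex.ofReal_re]

/-- **THE SYMBOL DOES NOT DEPEND ON THE BASE POINT.** [folklore] -/
theorem symbT_indep (hP : ∀ i, 1 ≤ P i) (X : Matrix ↥(boxDom P) ↥(boxDom P) ℝ) (hXs : X.IsSymm)
    (hX : ∀ (v : Fin (d + 1) → ℤ) (x y : ↥(boxDom P)),
      X ⟨wrap P (x.1 + v), wrap_mem_boxDom hP _⟩ ⟨wrap P (y.1 + v), wrap_mem_boxDom hP _⟩ = X x y)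
    (y₀ y₀' : ↥(boxDom P)) (p : Fin (d + 1) → ℤ) : symbT P X y₀ p = symbT P X y₀' p := by
  rw [symbT_eq_forms hP X hXs hX y₀ p, symbT_eq_forms hP X hXs hX y₀' p]

/-- **LÖWNER ORDER ⇒ SYMBOL ORDER**: `X ⪯ Y` as real quadratic forms ⇒ `symb X(p) ≤ symb Y(p)` for every `p` (both real symmetric
translation-invariant). [folklore] -/
theorem symbT_re_mono (hP : ∀ i, 1 ≤ P i) (X Y : Matrix ↥(boxDom P) ↥(boxDom P) ℝ) (hXs : X.IsSymm) (hYs : Y.IsSymm)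
    (hX : ∀ (v : Fin (d + 1) → ℤ) (x y : ↥(boxDom P)),
      X ⟨wrap P (x.1 + v), wrap_mem_boxDom hP _⟩ ⟨wrap P (y.1 + v), wrap_mem_boxDom hP _⟩ = X x y)
    (hY : ∀ (v : Fin (d + 1) → ℤ) (x y : ↥(boxDom P)),
      Y ⟨wrap P (x.1 + v), wrap_mem_boxDom hP _⟩ ⟨wrap P (y.1 + v), wrap_mem_boxDom hP _⟩ = Y x y)
    (hXY : ∀ φ : ↥(boxDom P) → ℝ, φ ⬝ᵥ X *ᵥ φ ≤ φ ⬝ᵥ Y *ᵥ φ) (y₀ : ↥(boxDom P)) (p : Fin (d + 1) → ℤ) :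
    (symbT P X y₀ p).re ≤ (symbT P Y y₀ p).re := by
  rw [symbT_re_eq hP X hXs hX y₀ p, symbT_re_eq hP Y hYs hY y₀ p]
  have hc : (0 : ℝ) < (Fintype.card ↥(boxDom P) : ℝ) := by exact_mod_cast card_boxDom_pos hP
  exact div_le_div_of_nonneg_right (add_le_add (hXY _) (hXY _)) hc.le

/-- `X ⪰ 0` ⇒ `symb X(p) ≥ 0`. [folklore] -/
theorem symbT_re_nonneg (hP : ∀ i, 1 ≤ P i) (X : Matrix ↥(boxDom P) ↥(boxDom P) ℝ) (hXs : X.IsSymm)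
    (hX : ∀ (v : Fin (d + 1) → ℤ) (x y : ↥(boxDom P)),
      X ⟨wrap P (x.1 + v), wrap_mem_boxDom hP _⟩ ⟨wrap P (y.1 + v), wrap_mem_boxDom hP _⟩ = X x y)
    (hpsd : ∀ φ : ↥(boxDom P) → ℝ, 0 ≤ φ ⬝ᵥ X *ᵥ φ) (y₀ : ↥(boxDom P)) (p : Fin (d + 1) → ℤ) :
    0 ≤ (symbT P X y₀ p).re := by
  rw [symbT_re_eq hP X hXs hX y₀ p]
  have hc : (0 : ℝ) < (Fintype.card ↥(boxDom P) : ℝ) := by exact_mod_cast card_boxDom_pos hP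
  exact div_nonneg (add_nonneg (hpsd _) (hpsd _)) hc.le

/-- `symb X(−p) = conj (symb X(p))` for every REAL matrix `X`. [folklore] -/
theorem symbT_neg_eq_conj (X : Matrix ↥(boxDom P) ↥(boxDom P) ℝ) (y₀ : ↥(boxDom P)) (p : Fin (d + 1) → ℤ) :
    symbT P X y₀ (-p) = starRingEnd ℂ (symbT P X y₀ p) := by
  unfold symbT
  rw [map_sum]
  refine Finset.sum_congr rfl fun y _ => ?_
  rw [map_mul, Complex.conj_ofReal, conj_chiT]

/-- **THE SYMBOL IS EVEN IN `p`** (clause (a′), evenness): `symb X(−p) = symb X(p)` for a real symmetric translation-invariant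
`X`. [folklore] -/
theorem symbT_neg (hP : ∀ i, 1 ≤ P i) (X : Matrix ↥(boxDom P) ↥(boxDom P) ℝ) (hXs : X.IsSymm)
    (hX : ∀ (v : Fin (d + 1) → ℤ) (x y : ↥(boxDom P)),
      X ⟨wrap P (x.1 + v), wrap_mem_boxDom hP _⟩ ⟨wrap P (y.1 + v), wrap_mem_boxDom hP _⟩ = X x y)
    (y₀ : ↥(boxDom P)) (p : Fin (d + 1) → ℤ) : symbT P X y₀ (-p) = symbT P X y₀ p := by
  rw [symbT_neg_eq_conj]
  exact Complex.conj_eq_iff_im.2 (symbT_im_eq_zero hP X hXs hX y₀ p)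

/-- **THE ROW IS EVEN**: `X(y₀, y₀ + v) = X(y₀, y₀ − v)` (representatives mod `P`) for a symmetric translation-invariant `X`.
[folklore] -/
theorem apply_wrap_add_eq (hP : ∀ i, 1 ≤ P i) (X : Matrix ↥(boxDom P) ↥(boxDom P) ℝ) (hXs : X.IsSymm)
    (hX : ∀ (v : Fin (d + 1) → ℤ) (x y : ↥(boxDom P)),
      X ⟨wrap P (x.1 + v), wrap_mem_boxDom hP _⟩ ⟨wrap P (y.1 + v), wrap_mem_boxDom hP _⟩ = X x y)
    (y₀ : ↥(boxDom P)) (v : Fin (d + 1) → ℤ) :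
    X y₀ ⟨wrap P (y₀.1 + v), wrap_mem_boxDom hP _⟩ = X y₀ ⟨wrap P (y₀.1 - v), wrap_mem_boxDom hP _⟩ := by
  have h := hX (-v) y₀ ⟨wrap P (y₀.1 + v), wrap_mem_boxDom hP _⟩
  have e : (⟨wrap P ((⟨wrap P (y₀.1 + v), wrap_mem_boxDom hP _⟩ : ↥(boxDom P)).1 + -v), wrap_mem_boxDom hP _⟩ :
      ↥(boxDom P)) = y₀ := by
    apply Subtype.ext
    show wrap P (wrap P (y₀.1 + v) + -v) = y₀.1
    rw [wrap_wrap_add, add_neg_cancel_right, wrap_eq_self y₀.2]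
  rw [e] at h
  rw [← h, sub_eq_add_neg]
  exact (hXs.apply _ _).symm

end Symbol

/-! ### §4 The doubled-torus two-cutoff line: symmetric, hence a real even symbol -/

section TorusLine

variable {n L : ℕ} [NeZero L] {T : Finset (Fin (d + 1) → ℤ)} {N Nf Nc : Fin (d + 1) → ℕ}

/-- run B's torus chart operator is symmetric. [folklore] -/
theorem torB_isSymm (hTL : IsBlockUnion L T) (hT : T = boxDom (dbl N)) (n : ℕ) (a : ℝ) : (torB hTL n a N).IsSymm := by
  unfold Matrix.IsSymm torB chartOp
  rw [transpose_smul, transpose_mul, transpose_mul, transpose_transpose, (torOpK_isSymm (n * L) a N hT).eq,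
    Matrix.mul_assoc]

/-- its hard Schur complement `A₁ − BD⁻¹C` is symmetric. [folklore] -/
theorem schurC_torB_isSymm (hTL : IsBlockUnion L T) (hT : T = boxDom (dbl N)) (n : ℕ) (a : ℝ) :
    (schurC (torB hTL n a N)).IsSymm := by
  set H := torB hTL n a N with hH
  have hblocks := (Matrix.isSymm_fromBlocks_iff.1 (by rw [fromBlocks_toBlocks H]; exact torB_isSymm hTL hT n a))
  obtain ⟨hA, hBC, hCB, hD⟩ := hblocks
  unfold schurC
  unfold Matrix.IsSymm at hA hD ⊢
  rw [transpose_sub, transpose_mul, transpose_mul, transpose_nonsing_inv, hA, hD, hBC, hCB, Matrix.mul_assoc]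

/-- **THE TORUS LINE IS SYMMETRIC** (every `s`, every `a`). [folklore] -/
theorem torLine_isSymm (hTL : IsBlockUnion L T) (hT : T = boxDom (dbl Nf)) (hTc : T.image (blk L) = boxDom (dbl Nc))
    (n : ℕ) (a s : ℝ) : (torLine hTL n a Nf Nc s).IsSymm := by
  unfold torLine
  rw [lineOpR_eq_schurC]
  exact ((torOpK_isSymm n a Nc hTc).smul (1 - s)).add ((schurC_torB_isSymm hTL hT n a).smul s)

variable {M : Fin (d + 1) → ℕ}

/-- the torus line on representatives is symmetric. [folklore] -/
theorem torLineRep_isSymm (hn : 1 ≤ n) (M : Fin (d + 1) → ℕ) (s : ℝ) : (torLineRep (L := L) hn M s).IsSymm := by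
  ext x y
  simp only [transpose_apply]
  unfold torLineRep
  exact (torLine_isSymm _ rfl (image_fineTor (NeZero.one_le : 1 ≤ L) n M) n 0 s).apply _ _

/-- **`σ_s(p)` AS TWO REAL QUADRATIC FORMS OF THE TORUS LINE**: `σ_s(p) = (⟨c_p, T^𝕋(s)c_p⟩ + ⟨s_p, T^𝕋(s)s_p⟩)∕|𝕋|`.
[folklore] -/
theorem torSymb_eq_forms (hn : 1 ≤ n) (hM : ∀ i, 1 ≤ M i) (s : ℝ) (y₀ : ↥(boxDom (dbl fun i => n * M i)))
    (p : Fin (d + 1) → ℤ) :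
    torSymb (L := L) hn M s y₀ p =
      ((((fun x : ↥(boxDom (dbl fun i => n * M i)) => (chiT (dbl fun i => n * M i) p x.1).re) ⬝ᵥ
            torLineRep (L := L) hn M s *ᵥ (fun x => (chiT (dbl fun i => n * M i) p x.1).re) +
          (fun x : ↥(boxDom (dbl fun i => n * M i)) => (chiT (dbl fun i => n * M i) p x.1).im) ⬝ᵥ
            torLineRep (L := L) hn M s *ᵥ (fun x => (chiT (dbl fun i => n * M i) p x.1).im)) /
        (Fintype.card ↥(boxDom (dbl fun i => n * M i)) : ℝ) : ℝ) : ℂ) :=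
  symbT_eq_forms (dbl_pos (mul_pos_side hn hM)) _ (torLineRep_isSymm hn M s)
    (fun v x y => torLineRep_transl hn hM s v x y) y₀ p

/-- **B-E1 (a′), REALITY: `σ_s(p) ∈ ℝ`** for every `s`, mesh `n`, `L`, torus `M`, dual index `p` (`a = 0`). [folklore] -/
theorem torSymb_im_eq_zero (hn : 1 ≤ n) (hM : ∀ i, 1 ≤ M i) (s : ℝ) (y₀ : ↥(boxDom (dbl fun i => n * M i)))
    (p : Fin (d + 1) → ℤ) : (torSymb (L := L) hn M s y₀ p).im = 0 :=
  symbT_im_eq_zero (dbl_pos (mul_pos_side hn hM)) _ (torLineRep_isSymm hn M s)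
    (fun v x y => torLineRep_transl hn hM s v x y) y₀ p

/-- `σ_s(p)` does not depend on the base point `y₀`. [folklore] -/
theorem torSymb_indep (hn : 1 ≤ n) (hM : ∀ i, 1 ≤ M i) (s : ℝ) (y₀ y₀' : ↥(boxDom (dbl fun i => n * M i)))
    (p : Fin (d + 1) → ℤ) : torSymb (L := L) hn M s y₀ p = torSymb (L := L) hn M s y₀' p :=
  symbT_indep (dbl_pos (mul_pos_side hn hM)) _ (torLineRep_isSymm hn M s)
    (fun v x y => torLineRep_transl hn hM s v x y) y₀ y₀' p

/-- **B-E1 (a′), EVENNESS: `σ_s(−p) = σ_s(p)`.** [folklore] -/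
theorem torSymb_neg (hn : 1 ≤ n) (hM : ∀ i, 1 ≤ M i) (s : ℝ) (y₀ : ↥(boxDom (dbl fun i => n * M i)))
    (p : Fin (d + 1) → ℤ) : torSymb (L := L) hn M s y₀ (-p) = torSymb (L := L) hn M s y₀ p :=
  symbT_neg (dbl_pos (mul_pos_side hn hM)) _ (torLineRep_isSymm hn M s)
    (fun v x y => torLineRep_transl hn hM s v x y) y₀ p

/-- **THE CONVOLUTION ROW OF THE TORUS LINE IS EVEN**: `T^𝕋(s)(y₀, y₀ + v) = T^𝕋(s)(y₀, y₀ − v)` (representatives). [folklore] -/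
theorem torLineRep_row_even (hn : 1 ≤ n) (hM : ∀ i, 1 ≤ M i) (s : ℝ) (y₀ : ↥(boxDom (dbl fun i => n * M i)))
    (v : Fin (d + 1) → ℤ) :
    torLineRep (L := L) hn M s y₀ ⟨wrap (dbl fun i => n * M i) (y₀.1 + v),
        wrap_mem_boxDom (dbl_pos (mul_pos_side hn hM)) _⟩ =
      torLineRep (L := L) hn M s y₀ ⟨wrap (dbl fun i => n * M i) (y₀.1 - v),
        wrap_mem_boxDom (dbl_pos (mul_pos_side hn hM)) _⟩ :=
  apply_wrap_add_eq (dbl_pos (mul_pos_side hn hM)) _ (torLineRep_isSymm hn M s)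
    (fun v x y => torLineRep_transl hn hM s v x y) y₀ v

/-- **FORM ORDER ⇒ SYMBOL ORDER for the torus line**: any symmetric translation-invariant `Y ⪯ T^𝕋(s)` on the representatives
has `symb Y(p) ≤ σ_s(p)`; the floors of files 39–40 enter B-E1 through this port. [folklore] -/
theorem symbT_re_le_torSymb_re (hn : 1 ≤ n) (hM : ∀ i, 1 ≤ M i) (s : ℝ)
    (Y : Matrix ↥(boxDom (dbl fun i => n * M i)) ↥(boxDom (dbl fun i => n * M i)) ℝ) (hYs : Y.IsSymm)
    (hY : ∀ (v : Fin (d + 1) → ℤ) (x y : ↥(boxDom (dbl fun i => n * M i))),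
      Y ⟨wrap (dbl fun i => n * M i) (x.1 + v), wrap_mem_boxDom (dbl_pos (mul_pos_side hn hM)) _⟩
        ⟨wrap (dbl fun i => n * M i) (y.1 + v), wrap_mem_boxDom (dbl_pos (mul_pos_side hn hM)) _⟩ = Y x y)
    (hle : ∀ φ : ↥(boxDom (dbl fun i => n * M i)) → ℝ, φ ⬝ᵥ Y *ᵥ φ ≤ φ ⬝ᵥ torLineRep (L := L) hn M s *ᵥ φ)
    (y₀ : ↥(boxDom (dbl fun i => n * M i))) (p : Fin (d + 1) → ℤ) :
    (symbT (dbl fun i => n * M i) Y y₀ p).re ≤ (torSymb (L := L) hn M s y₀ p).re :=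
  symbT_re_mono (dbl_pos (mul_pos_side hn hM)) Y _ hYs (torLineRep_isSymm hn M s) hY
    (fun v x y => torLineRep_transl hn hM s v x y) hle y₀ p

/-- and conversely `T^𝕋(s) ⪯ Y ⇒ σ_s(p) ≤ symb Y(p)`. [folklore] -/
theorem torSymb_re_le_symbT_re (hn : 1 ≤ n) (hM : ∀ i, 1 ≤ M i) (s : ℝ)
    (Y : Matrix ↥(boxDom (dbl fun i => n * M i)) ↥(boxDom (dbl fun i => n * M i)) ℝ) (hYs : Y.IsSymm)
    (hY : ∀ (v : Fin (d + 1) → ℤ) (x y : ↥(boxDom (dbl fun i => n * M i))),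
      Y ⟨wrap (dbl fun i => n * M i) (x.1 + v), wrap_mem_boxDom (dbl_pos (mul_pos_side hn hM)) _⟩
        ⟨wrap (dbl fun i => n * M i) (y.1 + v), wrap_mem_boxDom (dbl_pos (mul_pos_side hn hM)) _⟩ = Y x y)
    (hle : ∀ φ : ↥(boxDom (dbl fun i => n * M i)) → ℝ, φ ⬝ᵥ torLineRep (L := L) hn M s *ᵥ φ ≤ φ ⬝ᵥ Y *ᵥ φ)
    (y₀ : ↥(boxDom (dbl fun i => n * M i))) (p : Fin (d + 1) → ℤ) :
    (torSymb (L := L) hn M s y₀ p).re ≤ (symbT (dbl fun i => n * M i) Y y₀ p).re :=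
  symbT_re_mono (dbl_pos (mul_pos_side hn hM)) _ Y (torLineRep_isSymm hn M s) hYs
    (fun v x y => torLineRep_transl hn hM s v x y) hY hle y₀ p

end TorusLine

end Summit.QuantumFields.BalabanUV.T4Continuum.NE7K1LinTorusSymbolReal

end
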